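import Mathlib

/-!
# SoloBlind E63 — the congruence-module lemma behind THEOREM O (Brandt-module Eisenstein congruences)

Setting (informal): `X = ℤ[S]` is the Brandt module of a definite quaternion algebra, `deg : X → ℤ`
the degree, `e` the (primitive) Eisenstein vector with `deg e = d` (a multiple of the mass numerator),
and `t` a Hecke operator that kills the cuspidal part `X⁰ = ker deg` and acts on `e` by the Eisenstein
eigenvalue `lam`.  Conclusion: `d ∣ lam`.  Consequently the Eisenstein character induces a ring
surjection `T^{new}/I ↠ ℤ/d`, i.e. the new quotient carries Eisenstein depth at least `v_ℓ(d)`.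

Everything here is elementary additive-group algebra; no number theory is formalised.
-/

namespace Summit.Langlands.Langlands.Theorems

open AddMonoidHom

variable {X : Type*} [AddCommGroup X]

/-- The basic identity: if `t` kills `ker deg` and `t e = lam • e`, then for every `x`,
`(deg e) • t x = (lam * deg x) • e`. -/
theorem brandt_key_identity (deg : X →+ ℤ) (e : X) (t : X →+ X) (lam : ℤ)
    (ht0 : ∀ x, deg x = 0 → t x = 0) (hte : t e = lam • e) (x : X) :
    (deg e) • t x = (lam * deg x) • e := by
  have hker : deg ((deg e) • x - (deg x) • e) = 0 := by
    simp [map_sub, map_zsmul, mul_comm]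
  have h := ht0 _ hker
  rw [map_sub, map_zsmul, map_zsmul, hte, sub_eq_zero, smul_smul] at h
  rw [h, mul_comm]

/-- **Congruence-module lemma.**  Let `deg : X →+ ℤ` take the value `1` somewhere, let `e` be a
non-torsion, primitive vector (`k • y ∈ ℤe` with `k ≠ 0` forces `y ∈ ℤe`), and let `t` be an additive
endomorphism killing `ker deg` with `t e = lam • e`.  Then `deg e ∣ lam`. -/
theorem brandt_congruence_dvd (deg : X →+ ℤ) (e : X)
    (he : ∀ k : ℤ, k • e = 0 → k = 0)
    (hprim : ∀ (y : X) (k : ℤ), k ≠ 0 → (∃ a : ℤ, k • y = a • e) → ∃ b : ℤ, y = b • e)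
    (x₁ : X) (hx : deg x₁ = 1)
    (t : X →+ X) (lam : ℤ)
    (ht0 : ∀ x, deg x = 0 → t x = 0) (hte : t e = lam • e) :
    deg e ∣ lam := by
  have key := brandt_key_identity deg e t lam ht0 hte x₁
  rw [hx, mul_one] at key
  by_cases hd : deg e = 0
  · -- then `e ∈ ker deg`, so `t e = 0 = lam • e`, forcing `lam = 0`
    have h0 : t e = 0 := ht0 e hd
    rw [hte] at h0
    have := he lam h0
    simp [this]
  · obtain ⟨b, hb⟩ := hprim (t x₁) (deg e) hd ⟨lam, key⟩
    rw [hb, smul_smul] at key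
    -- key : (deg e * b) • e = lam • e
    have h2 : (deg e * b - lam) • e = 0 := by rw [sub_smul, key, sub_self]
    have h3 := he _ h2
    exact ⟨b, by linarith⟩

/-- Corollary in the form used by THEOREM O: if moreover `lam` is the Eisenstein eigenvalue of an
operator killing the cusp part, then `lam ≡ 0 [ZMOD deg e]`. -/
theorem brandt_congruence_modEq (deg : X →+ ℤ) (e : X)
    (he : ∀ k : ℤ, k • e = 0 → k = 0)
    (hprim : ∀ (y : X) (k : ℤ), k ≠ 0 → (∃ a : ℤ, k • y = a • e) → ∃ b : ℤ, y = b • e)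
    (x₁ : X) (hx : deg x₁ = 1)
    (t : X →+ X) (lam : ℤ)
    (ht0 : ∀ x, deg x = 0 → t x = 0) (hte : t e = lam • e) :
    lam ≡ 0 [ZMOD deg e] := by
  have h := brandt_congruence_dvd deg e he hprim x₁ hx t lam ht0 hte
  exact (Int.modEq_zero_iff_dvd.mpr h)

/-- Torsion-freeness consequence: an operator that kills `ker deg` AND has Eisenstein eigenvalue `0`
is zero (faithfulness bookkeeping: `Ann(X⁰) ∩ I = 0` inside `End X` when `X` is torsion-free and
`deg e ≠ 0`). -/
theorem brandt_ann_inter_eis_eq_zero (deg : X →+ ℤ) (e : X) (hd : deg e ≠ 0)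
    (htf : ∀ (k : ℤ) (y : X), k ≠ 0 → k • y = 0 → y = 0)
    (t : X →+ X) (ht0 : ∀ x, deg x = 0 → t x = 0) (hte : t e = 0) : t = 0 := by
  ext x
  have key := brandt_key_identity deg e t 0 ht0 (by simpa using hte) x
  simp only [zero_mul, zero_smul] at key
  simpa using htf (deg e) (t x) hd key

end Summit.Langlands.Langlands.Theorems
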